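import Mathlib
import Literature.AlgebraicGeometry.Resolution.WeightedResolutionDatum
import Literature.AlgebraicGeometry.Resolution.CobordantBlowupGlobal
import Literature.AlgebraicGeometry.Resolution.AffineBlowupUnique
import Literature.AlgebraicGeometry.Resolution.IdealSheafLemmas
import Summits.ResolutionOfSingularities.ResolutionOfSingularities.Theorems.WeightedInvariantWeightedThesisGlobalCobordantPlus
import Summits.ResolutionOfSingularities.ResolutionOfSingularities.Theorems.WeightedInvariantDatumToEmbeddedCentreHomogeneous
import Summits.ResolutionOfSingularities.ResolutionOfSingularities.Theorems.WeightedInvariantDatumToEmbeddedStrictTransformCharts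
import HarnessLib

/-!
# The invariant drops on the global cobordant blow-up

Topic: `Summits/ResolutionOfSingularities/ResolutionOfSingularities/Theorems`. Stub `stub_inv_drop`
of the line `Sketch` of the crux `Theses.WeightedInvariant.DatumToEmbedded` (statement
`stmt-ResolutionOfSingularities-0572`) of the summit
`Summit.ResolutionOfSingularities.ResolutionOfSingularities`.

Let `D` be a weighted resolution datum (`Literature/…/WeightedResolutionDatum.lean`),
`f : Y → Spec k` smooth separated quasi-compact over a perfect field of characteristic `p`, `I`
an ideal sheaf on `Y` with `inv` not everywhere minimal and maximal at `y₀`, and `R'` a Rees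
filtration on `Y` with the pieces of the datum's centre `R = D.centre f I`. Axiom `(iv)` of the
datum (`inv_cobordantPlus_lt`) is CHARTWISE, about the datum's own affine objects
`B₊(U) = R.cobordantPlus U = Spec Γ(U)[t⁻¹, Rₙ(U) tⁿ] ∖ Vert` with the strict transform
`R.cobordantStrictTransform U I` (the `t⁻¹`-saturation of `I(U) · Γ(U)[t⁻¹, Rₙ(U) tⁿ]`,
J. Włodarczyk, arXiv:2203.03090, Def. 2.3.5 and 3.3.12); the stub is the same drop at every point
of the GLOBAL cobordant blow-up `B₊ = R'.plus ⊆ B = Spec_Y ⊕ₙ 𝒥ₙ tⁿ` of the tree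
(`Literature/…/CobordantBlowupGlobal.lean`) with `R'.strictTransformPlus I`. Proof, as announced in
the datum file ("because `inv` is local, this chart-wise statement is equivalent to the drop on the
global cobordant blow-up, which glues these very charts"):

* ring level — over an affine `U`, the sections ring `⊕ₙ 𝒥ₙ(U) tⁿ` of `B` IS the datum's
  `Γ(U)[t⁻¹, Rₙ(U) tⁿ]` (`GlobalCobordantPlus.sectionsRing_eq_extReesAlgebra`, an equality of
  subalgebras of `Γ(U)[t, t⁻¹]`), whence a ring isomorphism `θ` that is the identity on Laurent
  polynomials (`exists_ringEquiv`); such a `θ` fixes `t⁻¹` and the structure map, maps the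
  irrelevant ideal `⊕_{n>0} 𝒥ₙ(U) tⁿ` onto the vertex ideal (`map_irrelevant`) and the
  `t⁻¹`-saturation of `K(U) · ⊕ 𝒥ₙ(U) tⁿ` onto the datum's strict transform `σˢ(K(U))`
  (`map_saturation`, by `mem_strictTransform_iff`);
* the chart `ψ_U = Spec θ ≫ R'.openCover.f U : B(U) ⟶ B` is an open immersion over
  `B(U) → U ⊆ Y` (`specMap_comp_π`, from `R'.ι_π`) matching the vertex complements
  (`specMap_mem_plusChart_iff`), so it restricts to `φ_U : B₊(U) ⟶ B₊` (`exists_fac`; everything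
  about `φ_U` is stated for any `φ` with `φ ≫ (B₊ ⊆ B) = (B₊(U) ⊆ B(U)) ≫ ψ_U`): an open immersion
  over `B₊(U) → U ⊆ Y` (`comp_πPlus_of_fac`), and the `φ_U` are jointly surjective
  (`exists_apply_eq_of_fac`, `B₊` being the union of the charts' vertex complements);
* `comap_specMap_strictTransform`, `comap_strictTransformPlus_of_fac` — **the global strict
  transform pulls back to the chart's**: on the chart the global `σˢ(K) = ⋃ₙ (π^*K : (t⁻¹)ⁿ)` has
  sections the `t⁻¹`-saturation (`StrictTransform.iSup_colon_ideal_chart`, the charts file of stub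
  `stub_strictTransform`), transported along `θ`;
* `stub_inv_drop` — at `y' = φ_U(b)`, locality of `inv` (axiom `(i)`, `inv_comap`, for the open
  immersion `φ_U`, smooth; the source `B₊(U) → Spec k` is smooth, separated and quasi-compact as
  the composite of `φ_U` with `B₊ → Spec k`, `B₊` being locally Noetherian) rewrites the global
  value as the chart's, which axiom `(iv)` bounds by `inv y₀`.

All proofs are glue on Mathlib and the tree; no definitions, no named facts.
-/

noncomputable section

open scoped LaurentPolynomial
open LaurentPolynomial CategoryTheory CategoryTheory.Limits AlgebraicGeometry TopologicalSpace
open Literature.AlgebraicGeometry.Resolution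
open Summit.ResolutionOfSingularities.ResolutionOfSingularities.Theorems

set_option linter.dupNamespace false -- mandated namespace `…Theorems.DatumToEmbedded.<Topic>`
-- `Γ(Y, U)` versus `Y.presheaf.obj (op U)` inside `rw` motives and instance problems:
set_option backward.isDefEq.respectTransparency false

namespace Summit.ResolutionOfSingularities.ResolutionOfSingularities.Theorems.DatumToEmbedded.InvDrop

universe u

/-! ## Ring level: `⊕ₙ 𝒥ₙ(U) tⁿ ≅ Γ(U)[t⁻¹, Jₙ tⁿ]` -/

section Ring

variable {A : Type u} [CommRing A] (F : IdealFiltration A) (J : ℕ → Ideal A)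

/-- **The identification `⊕ₙ 𝒥ₙ tⁿ ≅ A[t⁻¹, Jₙ tⁿ]`**: if the filtration has pieces `Jₙ`, its
coefficient-wise extended Rees algebra equals the datum's generated one
(`extReesAlgebra_eq_extendedRees`), whence a ring isomorphism that is the identity on Laurent
polynomials. [cite: Wlodarczyk2022, Def. 5.1.1] -/
theorem exists_ringEquiv (hJ : F.ideal = J) :
    ∃ θ : F.extendedRees ≃+* extReesAlgebra J, ∀ x, ((θ x : extReesAlgebra J) : A[T;T⁻¹]) = x := by
  subst hJ
  exact ⟨(Subalgebra.equivOfEq _ _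
    (WeightedThesis.DatumCobordantBridge.extReesAlgebra_eq_extendedRees F).symm).toRingEquiv,
    fun _ => rfl⟩

variable (θ : F.extendedRees ≃+* extReesAlgebra J)
  (hθ : ∀ x, ((θ x : extReesAlgebra J) : A[T;T⁻¹]) = x)

include hθ

/-- The inverse identification is the identity on Laurent polynomials too. [folklore] -/
theorem coe_symm_apply (x : extReesAlgebra J) : ((θ.symm x : F.extendedRees) : A[T;T⁻¹]) = x := by
  rw [← hθ (θ.symm x), θ.apply_symm_apply]

/-- The identification commutes with the structure maps. [folklore] -/
theorem ringEquiv_comp_algebraMap :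
    θ.toRingHom.comp (algebraMap A F.extendedRees) = algebraMap A (extReesAlgebra J) :=
  RingHom.ext fun a => Subtype.ext (hθ (algebraMap A F.extendedRees a))

/-- The identification maps `t⁻¹` to `t⁻¹`. [folklore] -/
theorem ringEquiv_T : θ ⟨T (-1), F.T_neg_one_mem_extendedRees⟩ = extReesAlgebra.tInv J :=
  Subtype.ext (hθ _)

/-- The identification maps the irrelevant ideal `⊕_{n>0} Jₙ tⁿ` onto the vertex ideal (same
generators `a tⁿ`, `n ≥ 1`, `a ∈ Jₙ`). [cite: Wlodarczyk2022, Def. 2.3.5] -/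
theorem map_irrelevant (hJ : F.ideal = J) :
    F.irrelevant.map θ.toRingHom = extReesAlgebra.vertexIdeal J := by
  subst hJ
  rw [IdealFiltration.irrelevant, Ideal.map_span, extReesAlgebra.vertexIdeal]
  congr 1
  ext x
  constructor
  · rintro ⟨p, ⟨n, a, hn, ha, hp⟩, rfl⟩
    exact ⟨n, hn, a, ha, (hθ p).trans hp⟩
  · rintro ⟨n, hn, a, ha, hx⟩
    exact ⟨θ.symm x, ⟨n, a, hn, ha, (coe_symm_apply F F.ideal θ hθ x).trans hx⟩,
      θ.apply_symm_apply x⟩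

/-- **The identification maps the `t⁻¹`-saturation `⋃ₙ (K₀ · ⊕ 𝒥ₙ tⁿ : (t⁻¹)ⁿ)` onto the strict
transform `σˢ(K₀)`** of the datum file (`mem_strictTransform_iff`).
[cite: Wlodarczyk2022, 3.3.12] -/
theorem map_saturation (K₀ : Ideal A) :
    (⨆ n : ℕ, (K₀.map (algebraMap A F.extendedRees)).colon
        ((Ideal.span {(⟨T (-1), F.T_neg_one_mem_extendedRees⟩ : F.extendedRees)} ^ n :
          Ideal F.extendedRees) : Set F.extendedRees)).map θ.toRingHom =
      extReesAlgebra.strictTransform J K₀ := by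
  have hK : (K₀.map (algebraMap A (extReesAlgebra J))).comap θ.toRingHom =
      K₀.map (algebraMap A F.extendedRees) := by
    rw [← ringEquiv_comp_algebraMap F J θ hθ, ← Ideal.map_map]
    exact Ideal.comap_map_of_bijective _ θ.bijective
  rw [StrictTransform.comap_iSup_colon_span_singleton_pow θ.toRingHom
    (K₀.map (algebraMap A (extReesAlgebra J))) (K₀.map (algebraMap A F.extendedRees))
    ⟨T (-1), F.T_neg_one_mem_extendedRees⟩ (extReesAlgebra.tInv J) (ringEquiv_T F J θ hθ) hK,
    Ideal.map_comap_of_surjective θ.toRingHom θ.surjective]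
  ext x
  rw [StrictTransform.mem_iSup_colon_span_singleton_pow_iff, extReesAlgebra.mem_strictTransform_iff]

end Ring

/-! ## The charts `B(U) ⟶ B` and `B₊(U) ⟶ B₊` of the global cobordant blow-up -/

section Chart

variable {Y : Scheme.{u}} (R' : ReesFiltration Y) (U : Y.affineOpens) (J : ℕ → Ideal Γ(Y, U))

/-- A point `b` of the datum's `B(U) = Spec Γ(U)[t⁻¹, Jₙ tⁿ]` lies in `B₊(U)` iff the vertex ideal
is not contained in `b`. [folklore] -/
theorem mem_plusOpens_iff (b : affineCobordantBlowup J) :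
    b ∈ affineCobordantBlowup.plusOpens J ↔ ¬ extReesAlgebra.vertexIdeal J ≤ b.asIdeal := by
  change b ∉ ((affineCobordantBlowup.vertex J).support : Set (affineCobordantBlowup J)) ↔ _
  rw [affineCobordantBlowup.vertex, affineCobordantBlowup.idealSheaf,
    show Scheme.IdealSheafData.ofIdealTop ((extReesAlgebra.vertexIdeal J).map
      (Scheme.ΓSpecIso (.of (extReesAlgebra J))).inv.hom) =
      affineBlowup.idealSheaf (extReesAlgebra.vertexIdeal J) from rfl,
    affineBlowup.support_idealSheaf, PrimeSpectrum.mem_zeroLocus, SetLike.coe_subset_coe]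

/-- Every point of `B₊` lies in the image of the vertex complement of the chart over some affine
open (`B₊` is their union). [folklore] -/
theorem exists_mem_image_plusChart (y' : (R'.plus : Scheme.{u})) :
    ∃ U : Y.affineOpens, y'.1 ∈ (R'.openCover.f ⟨U.1, U.2⟩) ''ᵁ R'.plusChart U := by
  obtain ⟨U, hU⟩ := Opens.mem_iSup.mp y'.2
  exact ⟨⟨U.1, U.2⟩, hU⟩

/-- **On a chart `Spec ⊕ 𝒥ₙ(U) tⁿ ⟶ B` over `U` compatible with `π` and `t⁻¹`, the strict
transform `σˢ(K)` pulls back to the ideal sheaf of the `t⁻¹`-saturation of `K(U) · ⊕ 𝒥ₙ(U) tⁿ`**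
(`StrictTransform.iSup_colon_ideal_chart`, moved to the top ideal of the affine chart).
[cite: Wlodarczyk2022, 3.3.12] -/
theorem comap_chart_strictTransform [IsLocallyNoetherian R'.cobordantBlowup]
    (g : Spec (CommRingCat.of (R'.sectionsRing U)) ⟶ R'.cobordantBlowup) [IsOpenImmersion g]
    (hgπ : g ≫ R'.π =
      Spec.map (CommRingCat.ofHom (algebraMap Γ(Y, U) (R'.sectionsRing U))) ≫ U.2.fromSpec)
    (hgA : g ≫ R'.toA1 = Spec.map (CommRingCat.ofHom (R'.polyToSections U)))
    (K : Y.IdealSheafData) :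
    (R'.strictTransform K).comap g =
      Scheme.IdealSheafData.ofIdealTop ((⨆ n : ℕ, ((K.ideal U).map
        (algebraMap Γ(Y, U) (R'.sectionsRing U))).colon
        ((Ideal.span {(⟨T (-1), (R'.filtration U).T_neg_one_mem_extendedRees⟩ :
          R'.sectionsRing U)} ^ n : Ideal (R'.sectionsRing U)) : Set (R'.sectionsRing U))).map
        (Scheme.ΓSpecIso (CommRingCat.of (R'.sectionsRing U))).inv.hom) := by
  refine Scheme.IdealSheafData.ext_of_isAffine (Eq.trans ?_ (ideal_ofIdealTop_top _).symm)
  rw [Scheme.IdealSheafData.ideal_comap_of_isOpenImmersion]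
  refine (congrArg (Ideal.comap (g.appIso ⊤).inv.hom)
    (StrictTransform.iSup_colon_ideal_chart R'.π R'.toA1 R' U g hgπ hgA K)).trans ?_
  rw [Ideal.comap_comap]
  refine Eq.trans ?_ (CentreHomogeneous.ideal_comap_iso_inv (Scheme.ΓSpecIso _).symm _)
  congr 1
  rw [← CommRingCat.hom_comp, Iso.inv_hom_id_assoc, Iso.symm_inv]

variable (θ : (R'.filtration U).extendedRees ≃+* extReesAlgebra J)
  (hθ : ∀ x, ((θ x : extReesAlgebra J) : (Γ(Y, U))[T;T⁻¹]) = x)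

/-- `Spec` of the identification is an isomorphism. [folklore] -/
theorem isIso_specMap : IsIso (Spec.map (CommRingCat.ofHom θ.toRingHom)) :=
  inferInstanceAs (IsIso (Spec.map θ.toCommRingCatIso.hom))

include hθ in
/-- **The chart `ψ_U = Spec θ ≫ (chart of B over U) : B(U) ⟶ B` lies over
`B(U) → Spec Γ(U) ≅ U ⊆ Y`** (`R'.ι_π`). [cite: Wlodarczyk2022, Def. 5.1.1] -/
theorem specMap_comp_π :
    (Spec.map (CommRingCat.ofHom θ.toRingHom) ≫ R'.openCover.f ⟨U.1, U.2⟩) ≫ R'.π =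
      affineCobordantBlowup.π J ≫ U.2.fromSpec := by
  rw [Category.assoc, R'.ι_π, ← Spec.map_comp_assoc]
  change Spec.map (CommRingCat.ofHom (θ.toRingHom.comp
    (algebraMap Γ(Y, U) (R'.filtration U).extendedRees))) ≫ _ = _
  rw [ringEquiv_comp_algebraMap _ J θ hθ]
  rfl

include hθ in
/-- **The identification matches the complements of the vertices**: a point of `B(U)` maps into
the chart's complement `R'.plusChart U` of `V(⊕_{n>0} 𝒥ₙ(U) tⁿ)` iff it lies in `B₊(U)`.
[cite: Wlodarczyk2022, Def. 2.3.5] -/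
theorem specMap_mem_plusChart_iff (hJ : (R'.filtration U).ideal = J) (b : affineCobordantBlowup J) :
    Spec.map (CommRingCat.ofHom θ.toRingHom) b ∈ R'.plusChart U ↔
      b ∈ affineCobordantBlowup.plusOpens J := by
  rw [R'.mem_plusChart_iff,
    show (Spec.map (CommRingCat.ofHom θ.toRingHom) b).asIdeal = b.asIdeal.comap θ.toRingHom
      from rfl,
    ← Ideal.map_le_iff_le_comap, map_irrelevant _ J θ hθ hJ, mem_plusOpens_iff]

include hθ in
/-- `ψ_U` maps `B₊(U)` into `B₊` (`image_plusChart_le_plus`). [folklore] -/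
theorem plusOpens_le_preimage_plus (hJ : (R'.filtration U).ideal = J) :
    affineCobordantBlowup.plusOpens J ≤
      (Spec.map (CommRingCat.ofHom θ.toRingHom) ≫ R'.openCover.f ⟨U.1, U.2⟩) ⁻¹ᵁ R'.plus :=
  fun b hb => R'.image_plusChart_le_plus ⟨U.1, U.2⟩
    ⟨_, (specMap_mem_plusChart_iff R' U J θ hθ hJ b).mpr hb, rfl⟩

include hθ in
/-- **The global strict transform pulls back to the chart's**: along `ψ_U : B(U) ⟶ B`, `σˢ(K)`
pulls back to the ideal sheaf of the datum's `σˢ(K(U)) ⊆ Γ(U)[t⁻¹, Jₙ tⁿ]`.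
[cite: Wlodarczyk2022, 3.3.12] -/
theorem comap_specMap_strictTransform [IsLocallyNoetherian R'.cobordantBlowup]
    (K : Y.IdealSheafData) :
    (R'.strictTransform K).comap
        (Spec.map (CommRingCat.ofHom θ.toRingHom) ≫ R'.openCover.f ⟨U.1, U.2⟩) =
      affineCobordantBlowup.idealSheaf J (extReesAlgebra.strictTransform J (K.ideal U)) := by
  rw [Scheme.IdealSheafData.comap_comp, comap_chart_strictTransform R' U
    (R'.openCover.f ⟨U.1, U.2⟩) (R'.ι_π ⟨U.1, U.2⟩) (R'.ι_toA1 ⟨U.1, U.2⟩) K,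
    comap_ofIdealTop_SpecMap, map_saturation _ J θ hθ]
  rfl

include hθ in
/-- **The chart `φ_U : B₊(U) ⟶ B₊` exists**: `ψ_U` restricted to the vertex complements.
[cite: Wlodarczyk2022, Def. 5.1.1] -/
theorem exists_fac (hJ : (R'.filtration U).ideal = J) :
    ∃ φ : affineCobordantBlowup.plus J ⟶ (R'.plus : Scheme.{u}), φ ≫ R'.plus.ι =
      (affineCobordantBlowup.plusOpens J).ι ≫
        Spec.map (CommRingCat.ofHom θ.toRingHom) ≫ R'.openCover.f ⟨U.1, U.2⟩ :=
  ⟨Scheme.Hom.resLE _ R'.plus (affineCobordantBlowup.plusOpens J)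
    (plusOpens_le_preimage_plus R' U J θ hθ hJ), Scheme.Hom.resLE_comp_ι _ _⟩

variable (φ : affineCobordantBlowup.plus J ⟶ (R'.plus : Scheme.{u}))
  (hφ : φ ≫ R'.plus.ι = (affineCobordantBlowup.plusOpens J).ι ≫
    Spec.map (CommRingCat.ofHom θ.toRingHom) ≫ R'.openCover.f ⟨U.1, U.2⟩)

include hφ

/-- `φ_U` is an open immersion. [folklore] -/
theorem isOpenImmersion_of_fac : IsOpenImmersion φ := by
  haveI := isIso_specMap R' U J θ
  haveI : IsOpenImmersion (φ ≫ R'.plus.ι) := by rw [hφ]; infer_instance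
  exact IsOpenImmersion.of_comp φ R'.plus.ι

include hθ in
/-- **`φ_U` lies over `σ₊ : B₊(U) → U ⊆ Y`.** [cite: Wlodarczyk2022, Def. 2.3.5] -/
theorem comp_πPlus_of_fac : φ ≫ R'.πPlus = affineCobordantBlowup.plusπ J ≫ U.2.fromSpec := by
  rw [ReesFiltration.πPlus, ← Category.assoc, hφ, Category.assoc, specMap_comp_π R' U J θ hθ]
  rfl

include hθ in
/-- **The strict transform on `B₊` pulls back along `φ_U` to the chart's strict transform on
`B₊(U)`** (the datum's `affineCobordantBlowup.strictTransformPlus`).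
[cite: Wlodarczyk2022, 3.3.13] -/
theorem comap_strictTransformPlus_of_fac [IsLocallyNoetherian R'.cobordantBlowup]
    (K : Y.IdealSheafData) :
    (R'.strictTransformPlus K).comap φ =
      affineCobordantBlowup.strictTransformPlus J (K.ideal U) := by
  rw [ReesFiltration.strictTransformPlus, ← Scheme.IdealSheafData.comap_comp, hφ,
    Scheme.IdealSheafData.comap_comp, comap_specMap_strictTransform R' U J θ hθ]
  rfl

include hθ in
/-- **Joint surjectivity**: every point of `B₊` lying in the image of the chart's vertex complement
over `U` is in the image of `φ_U`. [folklore] -/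
theorem exists_apply_eq_of_fac (hJ : (R'.filtration U).ideal = J) (y' : (R'.plus : Scheme.{u}))
    (hy' : y'.1 ∈ (R'.openCover.f ⟨U.1, U.2⟩) ''ᵁ R'.plusChart U) :
    ∃ b : affineCobordantBlowup.plus J, φ b = y' := by
  obtain ⟨q, hq, hqy⟩ := hy'
  haveI := isIso_specMap R' U J θ
  let e := Spec.map (CommRingCat.ofHom θ.toRingHom)
  let b : affineCobordantBlowup J := inv e q
  have hb : e b = q := by
    change (inv e ≫ e) q = q
    rw [IsIso.inv_hom_id]
    rfl
  refine ⟨⟨b, (specMap_mem_plusChart_iff R' U J θ hθ hJ b).mp (hb ▸ hq)⟩, Subtype.ext ?_⟩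
  have h := congrArg (fun ψ => (ψ ⟨b, (specMap_mem_plusChart_iff R' U J θ hθ hJ b).mp (hb ▸ hq)⟩ :
    R'.cobordantBlowup)) hφ
  simp only [Scheme.Hom.comp_apply, Scheme.Opens.ι_apply] at h
  rw [h, ← hqy]
  exact congrArg _ hb

end Chart

/-! ## The stub -/

/-- **STUB `stub_inv_drop`** of the line `Sketch` of crux `DatumToEmbedded`: **the invariant drops
on the GLOBAL cobordant blow-up.** For a weighted resolution datum `D`, `f : Y → Spec k` smooth
separated quasi-compact over a perfect field, an ideal sheaf `I` with `inv` not everywhere minimal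
and maximal at `y₀`, and a Rees filtration `R'` with the pieces of the centre `D.centre f I` whose
cobordant blow-up `B₊ = R'.plus → Y → Spec k` is smooth separated quasi-compact, at every point
`y'` of `B₊` the invariant of `(B₊, σˢ(I)|_{B₊})` is strictly below `inv y₀`: `y' = φ_U(b)` for the
chart `φ_U : B₊(U) ⟶ B₊` over some affine `U` (`exists_apply_eq_of_fac`), an open immersion over
`B₊(U) → U ⊆ Y` pulling `σˢ(I)|_{B₊}` back to the datum's chartwise strict transform
(`comap_strictTransformPlus_of_fac`), so locality of `inv` (axiom `(i)`, `inv_comap`) rewrites the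
value at `y'` as the chart's value at `b`, which axiom `(iv)` (`inv_cobordantPlus_lt`) bounds
(Włodarczyk 2022, §3.3.33 "`maxinv_X = maxinv_B > maxinv_{B₊}`", Thm. 4.3.1).
[cite: Wlodarczyk2022, Thm. 4.3.1] -/
theorem stub_inv_drop :
    ∀ {p : ℕ} (D : WeightedResolutionDatum p) {k : Type} [Field k] [CharP k p] [PerfectField k]
      {Y : Scheme.{0}} (f : Y ⟶ Spec (.of k)) [Smooth f] [IsSeparated f] [QuasiCompact f]
      (I : Y.IdealSheafData), (∃ y : Y, ¬ IsBot (D.inv f I y)) → ∀ (y₀ : Y),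
      (∀ y : Y, D.inv f I y ≤ D.inv f I y₀) →
      ∀ (R' : ReesFiltration Y), R'.ideal = (D.centre f I).piece →
      ∀ [Smooth (R'.πPlus ≫ f)] [IsSeparated (R'.πPlus ≫ f)] [QuasiCompact (R'.πPlus ≫ f)],
      ∀ y' : (R'.plus : Scheme.{0}),
        D.inv (R'.πPlus ≫ f) (R'.strictTransformPlus I) y' < D.inv f I y₀ := by
  intro p D k _ _ _ Y f _ _ _ I hguard y₀ hmax R' hR' _ _ _ y'
  have hJ : ∀ U : Y.affineOpens, (R'.filtration U).ideal = (D.centre f I).chartIdeals U :=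
    fun U => funext fun n => by rw [ReesFiltration.filtration_ideal, hR']; rfl
  -- `B` and `B₊` are locally Noetherian (the centre is a regular weighted centre under the guard)
  haveI : IsLocallyNoetherian Y := LocallyOfFiniteType.isLocallyNoetherian f
  haveI : LocallyOfFiniteType R'.π := WeightedThesis.GlobalCobordantPlus.locallyOfFiniteType_π
    (D.centre f I) R' hR' (D.isRegularWeightedCentre_centre f I hguard)
  haveI : IsLocallyNoetherian R'.cobordantBlowup := LocallyOfFiniteType.isLocallyNoetherian R'.π
  haveI : IsLocallyNoetherian (R'.plus : Scheme.{0}) :=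
    LocallyOfFiniteType.isLocallyNoetherian (R'.πPlus ≫ f)
  -- `y' = φ b` for the chart `φ = φ_U` over some affine `U`
  obtain ⟨U, hU⟩ := exists_mem_image_plusChart R' y'
  obtain ⟨θ, hθ⟩ := exists_ringEquiv (R'.filtration U) ((D.centre f I).chartIdeals U) (hJ U)
  obtain ⟨φ, hφ⟩ := exists_fac R' U _ θ hθ (hJ U)
  haveI := isOpenImmersion_of_fac R' U _ θ φ hφ
  obtain ⟨b, rfl⟩ := exists_apply_eq_of_fac R' U _ θ hθ φ hφ (hJ U) y' hU
  -- the chart is a smooth `Y`-morphism from a smooth separated quasi-compact `k`-scheme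
  have hφf : φ ≫ R'.πPlus ≫ f = (D.centre f I).cobordantPlusι U ≫ f := by
    rw [← Category.assoc, comp_πPlus_of_fac R' U _ θ hθ φ hφ]
    rfl
  haveI : Smooth ((D.centre f I).cobordantPlusι U ≫ f) := by rw [← hφf]; infer_instance
  haveI : IsSeparated ((D.centre f I).cobordantPlusι U ≫ f) := by rw [← hφf]; infer_instance
  haveI : QuasiCompact ((D.centre f I).cobordantPlusι U ≫ f) := by rw [← hφf]; infer_instance
  -- locality of `inv` along the chart, then axiom `(iv)` on the chart
  have key := D.inv_comap (R'.πPlus ≫ f) ((D.centre f I).cobordantPlusι U ≫ f) φ hφf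
    (R'.strictTransformPlus I) b
  rw [comap_strictTransformPlus_of_fac R' U _ θ hθ φ hφ] at key
  exact key.symm.trans_lt (D.inv_cobordantPlus_lt f I hguard U b y₀ hmax)

end Summit.ResolutionOfSingularities.ResolutionOfSingularities.Theorems.DatumToEmbedded.InvDrop

end
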